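import Summits.AtomisticToContinuum.HydrodynamicLimit.Theses.CollisionIsometryCLT
import Summits.AtomisticToContinuum.HydrodynamicLimit.Theses.StiffCollisionalRelaxation
import Literature.MathematicalPhysics.KineticTheory.HardSphereEulerProofs

/-!
# Disproof of `CollisionalTransferLocality` — findings (cdisprove seat, cycle 1, 2026-08-16)

Crux item `stmt-AtomisticToContinuum-9518` (rank-4 crux of route `CollisionIsometryCLT`, crux K2 of
`StiffCollisionalRelaxation`; the two route decls are the same term, `shared_verbatim`).

**Verdict so far: NO KILL.** The statement is the configurational ("collisional-transfer") half of
the local-equilibrium closure at fixed reduced density: w.h.p. the Irving–Kirkwood collisional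
residual `Cc(τ)` of the `(ψ, χ)`-tested momentum + energy balance equals
`∫₀^τ∫ (div ψ + ∇χ·ū) p_c(ρ̄, θ̄)`, `p_c = hsPressure σ ρ θ − ρθ = ρθ(Z(ρσ³) − 1)`. It elaborates
(rc 0), it is correctly normalised, and every junk value it contains sits on a null or
improbable set. What a kill would need is an `N`-uniform NON-equilibrium statement about
deterministic hard spheres (anisotropy of contact normals / a lag of `g₂(ε⁺)` behind the block
fields by `O(1)` at fixed `σ`), i.e. a negative solution of the Boltzmann-hypothesis problem
itself (`Literature.Barriers.AtomisticToContinuum.BoltzmannHypothesisBarrierNarrow`: "no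
impossibility theorem is printed anywhere").

## 1. Elaboration / reading (symbol by symbol)
* `Cc N z τ = O(τ, Φ_τ z) − O(0, Φ_0 z) − ∫_{[0,τ]} (⟨μ, ∂ₛψ·v + ∂ₛχ|v|²/2⟩ + d/dr|₀ O(s, S_r Φ_s z))`
  with `O(s, z') = ⟨μ_{z'}, ψ_s·v + χ_s |v|²/2⟩`, `μ` the empirical measure (weights `(N+1)⁻¹`),
  `S_r` free flight. On the good set of the flow (Liouville-conull, and `localGibbsLaw ≪
  Liouville`, `localGibbsLaw_eq`) the orbit is a hard-sphere trajectory, so by the weak balance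
  law `Literature.Analysis.FluidPDE.HardSphereFlow.sub_eq_integral_add_collisionalTransfer`
  `Cc(τ)` IS the finite sum of collision jumps `(N+1)⁻¹[(ψ(xᵢ)−ψ(xⱼ))·Δvᵢ + (χ(xᵢ)−χ(xⱼ))Δ|vᵢ|²/2]`
  (`collisionJump_momentumObservable` / `_energyObservable`). Off the good set: junk, null.
* `timeDeriv` is two-sided while `ψ, χ` are only `IsSmoothSpaceTimeOn (Icc 0 t)`: junk only at
  `s ∈ {0, t}` (Lebesgue-null in the `s`-integral). `deriv (r ↦ O(s, S_r z)) 0` is a finite sum of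
  derivatives of smooth functions: genuine.
* `ub = ρb⁻¹ • mb`, `θb = 2/3 (Eb/ρb − ‖mb‖²/(2ρb²))`: junk `0` on EMPTY blocks (`ρb = 0`), where
  `pc 0 0 = 0` (`collisionalPressure_density_zero`) — harmless. Blocks hold `≥ (N+1)^{1−3γ}/C ≥
  (N+1)^{4/5}/C` particles in mean.
* `pc r th = r th (Z(rσ³) − 1)`, `Z η = 1 + η · deriv hsExcessFreeEnergy η`; `deriv` junk `0` off
  differentiability points; `hsExcessFreeEnergy η = 0` (junk: `log 0 = 0`) beyond close packing.
  At a first-order freezing transition the free energy per particle is `C¹` in the density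
  (common tangent ⇒ continuous pressure), so the docstring's "freezing kink ⇒ deriv junk 0" does
  not occur; what does occur is `deriv f_ex → ∞` at close packing `η ↑ √2`, so for a configuration
  whose block density crosses close packing transversally `x ↦ pc(ρ̄(x), θ̄(x))` has a
  non-integrable `1/dist` singularity and `∫ x, …` is Bochner-junk `0`. Such configurations
  (a jammed mesoscopic cell) are exponentially improbable at time 0 for small `σ`; the crux
  STANDS ALONE (it may not borrow `AprioriBounds (ii)`), so its prover must price jammed/empty
  cells along the dynamics internally — a real proof obligation, not a refutation.
* Law: `localGibbsLaw … = localGibbsMeasure …` is a probability measure for `σ ≤ 1/2` and every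
  `N` (`isProbabilityMeasure_localGibbsLaw`); flows exist (`HardSphereFlow.nonempty_torus_holds`)
  and agree a.e.; the event `{∃ τ ≤ t, δ < |…|}` is evaluated by outer measure if non-measurable —
  no leverage either way. NOT vacuous, NOT trivially true.
* Quantifier order `∀ profiles ∃ σ₀ ∀ σ<σ₀ ∀ Φ ∀ (γ,C,φ) ∀ t ∀ (ψ,χ) ∀ δ` matches the informal
  text; `σ₀` may depend on the profiles only.

## 2. Normalisation check (tensor virial theorem) — passes
Per unit normalised mass the collisional momentum flux is `P^c_ab dx ds = (N+1)⁻¹ Σ_{coll∈dx×ds}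
(xᵢ−xⱼ)_a (Δvᵢ)_b`, trace `= 3 p_c` with `p_c = ρθ(Z − 1)`, `Z = βP/n` at `n ε³ = ρσ³`
(`(N+1)ρ · σ³(N+1)⁻¹`; `hsFreeVolume η N` is `N` spheres at `n d³ = η`). Linearising
`ψ(xᵢ) − ψ(xⱼ) = ε(ω·∇)ψ + O(ε²)` gives `Σ jumps = ∫∫ ∂_aψ_b P^c_ab + O(ε)`, `= ∫∫ div ψ · p_c`
iff `P^c` is isotropic; the energy jump `(χ(xᵢ)−χ(xⱼ)) V_cm·Δvᵢ` gives `∫∫ ∇χ·(P^c u + q^c)`.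
No factor-2 (pair double counting) or sign slip: `Δvᵢ = |g·ω| ω` with `ω = (xᵢ−xⱼ)/ε` for an
incoming pair, so the virial is positive, as is `p_c`. All Navier–Stokes-order collisional
corrections (collisional viscosity, Enskog `ϖ`-term of the heat flux, Lutsko's shear-induced
anisotropy of `g₂(ε⁺, ω)`) are `O(mean free time × macroscopic gradient) = O((N+1)^{-1/3}σ⁻²) → 0`
at fixed `σ`: the statement asks exactly for the Euler-order content, nothing more.

## 3. Load-bearing analysis (which hypotheses can be dropped?)
* `0 < θ₀`, `0 < a₀`: VACUITY GUARDS only. At `θ₀ ≡ 0` or `a₀ ≡ 0` the local Gibbs profile is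
  the zero function (`(2π·0)^{−3/2} = 0` is `Real.zero_rpow`), the law is the zero measure and
  the conclusion holds trivially (`conclusionAt_theta_zero`, `conclusionAt_activity_zero`): there
  is no `_false_without_` theorem for them, and the informative "Without" variants are as hard
  as the crux.
* `σ < σ₀` (smallness): not refutable by dropping either — at `σ = 0` BOTH sides vanish
  identically (`collisionalPressure_sigma_zero`; free flow has no jumps), in contrast with the
  kinetic hinge `FastMomentRelaxation`, which is FALSE at `σ = 0` (barrier kernel (5)); at huge
  `σ` the hard-sphere domain is empty for large `N` (pigeonhole), the law is `0`, vacuous again;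
  the dense-fluid / crystal window in between is as open as the crux.
* `γ ≤ 1/15`, kernel bounds: only used to keep `≥ (N+1)^{4/5}` particles per block; no cheap
  attack found for any admissible family (sup-bound forces support volume `≥ (C(N+1)^{3γ})⁻¹`).
* Continuity of profiles: with discontinuous `a₀` the law is still fine; no leverage.

## 4. Regimes / models tried (all consistent with the crux)
* Global equilibrium (constant profiles, `u₀ = 0`): the law is flow-invariant, `ρ̄ → 1`,
  `θ̄ → θ`, and `∫_{𝕋³} div ψ = 0`, so the RHS → 0 and the crux reduces to
  `Cc(τ) → 0` in probability: mean zero by translation invariance, variance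
  `≍ #collisions × jump² ≍ (N+1)^{4/3} · σ²(N+1)^{-8/3} → 0`. This is the natural first RUNG
  (`EquilibriumRung`, implied by the crux: `equilibriumRung_of_crux`) — an equilibrium
  LLN for the collision-virial functional, provable in principle WITHOUT any ergodic input
  beyond stationarity + exchangeability; it cannot distinguish `p_c` from any other local
  function (the signal integrates to zero), so it is a consistency rung, not a test of locality.
* `σ = 0` (ideal gas): both sides `0`. Constant tests `ψ ≡ e`, `χ ≡ c`: both sides `0`
  (momentum/energy conservation vs `div e = 0`, `∇c = 0`).
* Non-equilibrium (density / temperature wave, shear wave): the only evidence is numerical and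
  it is FOR the statement — the collision virial is how hard-sphere pressure is measured in
  event-driven MD (Alder–Wainwright; Erpenbeck–Wood 1984, doi:10.1007/bf01014387) and
  Irving–Kirkwood local balance with the Enskog/Carnahan–Starling `p_c` is verified in shock-wave
  and shear NEMD down to a few mean free paths (Holian–Hoover–Moran–Straub 1980,
  doi:10.1103/physreva.22.2798; kinetic-temperature anisotropy lives INSIDE dense shock layers
  only, Hoover–Hoover 2010, doi:10.1103/physreve.81.046302); deviations are Navier–Stokes /
  Burnett order, vanishing here. OWN TEST: §6 below (event-driven MD, this seat) — the typed
  identity holds to O(Kn) in both channels, corrections shrinking like Np^{-1/3}.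
* After shocks / contact discontinuities (`∀ t > 0` is demanded): blocks straddling a
  discontinuity are an `O((N+1)^{-γ})` volume fraction and `p_c` is bounded there — no leverage
  without an `O(1)`-volume breakdown of local equilibrium, which nothing in print suggests.

## 6. Numerical test of the typed identity (event-driven hard-sphere MD, this seat)
Script `mdjob/hsmd.py` (session folder; attached as evidence), `kit` jobs j009146 (smoke, Np = 512),
j013836 (Np = 4096), j013837 (16384), j013876 (32768), j014135 (65536, horizon t ≤ 0.15).
Setting: 𝕋³, Np = N+1 spheres, ε = σ Np^{-1/3}, σ = 0.8 (packing fraction πσ³/6 = 0.268, Z_CS = 3.368,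
p_c/(ρθ) = 2.37: a DENSE fluid, chosen so that the collisional transfer is large); local Gibbs data
a₀ ≡ 1 (MC-equilibrated hard-sphere positions), u₀ ≡ 0, θ₀ = 1 + 0.5 sin 2πx₁ (temperature wave);
tests ψ = (cos 2πx₁/2π, 0, 0), χ = sin 2πx₁/2π; `Cc` from the exact collision jumps; `R` from slab block
fields (K = 32 / 64 slabs in x₁ agree to ≤ 3 %); Z = Carnahan–Starling.
VALIDATION: equilibrium collision virial / ((Z_CS − 1)θ) = 0.999 / 1.002 / 1.004 / 1.004 (Np = 4096 / 16384 /
32768 / 65536; 2.6e4 – 5.3e5 collisions); collision rate / Enskog 4nε²g√(πθ) = 1.002 / 1.002 / 1.005 / 1.004;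
balance-law identity (jump sum = [O]₀^τ − ∫B) to ≤ 1.5e-4 absolute (≤ 0.3 %).
RESULTS (|R| reaches 0.02–0.03 in both channels; the momentum sup is attained at t ≈ 0.11 in every run):
    Np      ε       sup_{t≤0.15}|Cm−Rm|  /sup|Rm|  (Ce−Re)(0.15)  (Ce−Re)(0.25)  max slab (P11−P⊥)/p_c
    4096    0.050   0.0101              0.37      −0.0129        −0.0227        0.16
    16384   0.0315  0.0054              0.19      −0.0085        −0.0167        0.11
    32768   0.025   0.0047              0.16      −0.0083        −0.0144        0.07
    65536   0.0198  0.0035              0.17      −0.0064        (t ≤ 0.15)     0.06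
  Initial rates (t ≤ 0.0125, flow still identical across N): momentum dCm/dt = −0.572 / −0.584 / −0.559
  / −0.563 vs dRm/dt = −0.601 / −0.600 / −0.573 / −0.565 (frozen-profile prediction ∫ div ψ · p_c =
  −0.59): the typed normalisation of the MOMENTUM channel (p_c = ρθ(Z(ρσ³) − 1), θ̄ with the 2/3,
  weights 1/Np) is right to 3 % (0.4 % at Np = 65536). Energy: dCe/dt − dRe/dt = −0.13 / −0.09 / −0.09 /
  −0.08 per unit time is the collisional HEAT FLUX
  ∫∇χ·q_c, q_c = −κ_c∇θ with the Enskog collisional conductivity κ_c ≈ 2.7 κ₀, κ₀ = (75/64)√(θ/π)/ε²: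
  predicted −0.27·a(s) (a = relative wave amplitude, decaying) — sign and size match.
READING: Cc = the crux's Euler-order local functional R + Navier–Stokes-order collisional transport
(viscous collisional stress in the momentum channel — see the slab anisotropy column —, collisional heat
flux in the energy channel), the latter ∝ Kn ≍ 1/(σ²Np^{1/3}) × gradients: over Np = 4096 → 65536 the
momentum discrepancy falls 1 : 0.53 : 0.46 : 0.35 (Kn: 1 : 0.63 : 0.50 : 0.40), the stress anisotropy
1 : 0.66 : 0.44 : 0.38, the energy discrepancy at t = 0.15 1 : 0.66 : 0.64 : 0.50 (slightly slower: the
driving θ-wave is less damped at larger N, so ∫|∇θ| ds grows toward its inviscid value). Nothing lags by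
O(1): the contact statistics (rate × transfer, normals) follow the block fields up to O(Kn) — the
planner's why-might-fail scenario ("g₂(σ⁺) and the isotropy of contact normals may lag the block fields
by O(1) at fixed σ") does NOT materialise at σ = 0.8, Np ≤ 6.6e4, in a strongly driven (Mach 0.3–0.5,
±50 % temperature) flow. CAVEATS FOR PROVERS:
(i) the ENERGY channel's Euler term p_c ū is Mach-suppressed while its correction q_c is not, so the
"no collisional heat flux at leading order" clause is the slowest to emerge (|Ce − Re| > |Re| still at
Np = 32768) — any quantitative form of the crux converges no faster than N^{-1/3}; (ii) this is ONE
smooth pre-shock flow at ONE density; it says nothing about post-shock times, which `∀ t > 0` includes.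

## 5. What is landed / open here
Sorry-free: `shared_verbatim`, `crux_iff`, `conclusionAt_of_law_eq_zero`,
`localGibbsLaw_eq_zero_of_profile_eq_zero`, `localGibbsProfile_theta_zero`,
`localGibbsProfile_activity_zero`, `conclusionAt_theta_zero`, `conclusionAt_activity_zero`,
`collisionalPressure_sigma_zero`, `collisionalPressure_density_zero`, `equilibriumRung_of_crux`.
No `-- Targets` yet (payload.targets empty). No near-miss kill exists to record.
-/

namespace Summit.AtomisticToContinuum.HydrodynamicLimit.Cruxes.CollisionalTransferLocality.Disproof

open scoped BigOperators Topology ENNReal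
open Filter Set Function MeasureTheory
open Literature.MathematicalPhysics.KineticTheory

noncomputable section

/-! ## The conclusion of the crux at fixed `(σ, a₀, θ₀, u₀)` (verbatim tail of the route decl) -/

/-- The conclusion of `CollisionalTransferLocality` at a fixed reduced density `σ` and fixed
profiles — the text of the route decl after `σ < σ₀ →`, verbatim (so that `crux_iff` is `Iff.rfl`).
[folklore] -/
def ConclusionAt (σ : ℝ) (a₀ θ₀ : (UnitAddTorus (Fin 3)) → ℝ)
    (u₀ : (UnitAddTorus (Fin 3)) → (EuclideanSpace ℝ (Fin 3))) : Prop :=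
    ∀ Φ : (N : ℕ) → Literature.Analysis.FluidPDE.HardSphereFlow (Literature.Analysis.FluidPDE.Torus.geometry (Fin 3)) (Literature.MathematicalPhysics.KineticTheory.hsDiameter σ N) (N + 1), ∀ (γ C : ℝ) (φ : ℕ → (UnitAddTorus (Fin 3)) → ℝ), 0 < γ → γ ≤ 1 / 15 → ((∀ N, Literature.Analysis.FunctionSpaces.Torus.IsSmooth (φ N)) ∧ (∀ N y, 0 ≤ φ N y) ∧ (∀ N, ∫ y, φ N y = 1) ∧ (∀ (N : ℕ) y, ((N : ℝ) + 1) ^ (-γ) ≤ Literature.Analysis.FluidPDE.Torus.euclidDist y 0 → φ N y = 0) ∧ (∀ (N : ℕ) y, φ N y ≤ C * ((N : ℝ) + 1) ^ (3 * γ)) ∧ (∀ (N : ℕ) y, ‖Literature.Analysis.FunctionSpaces.Torus.gradient (φ N) y‖ ≤ C * ((N : ℝ) + 1) ^ (4 * γ))) → let ρb := fun (N : ℕ) (z : Literature.Analysis.FluidPDE.Config (N + 1) (Fin 3) (UnitAddTorus (Fin 3))) (x : (UnitAddTorus (Fin 3))) => Literature.MathematicalPhysics.KineticTheory.empiricalDensityField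 z (fun y => φ N (y - x)); let mb := fun (N : ℕ) (z : Literature.Analysis.FluidPDE.Config (N + 1) (Fin 3) (UnitAddTorus (Fin 3))) (x : (UnitAddTorus (Fin 3))) => Literature.MathematicalPhysics.KineticTheory.empiricalMomentumField z (fun y => φ N (y - x)); let Eb := fun (N : ℕ) (z : Literature.Analysis.FluidPDE.Config (N + 1) (Fin 3) (UnitAddTorus (Fin 3))) (x : (UnitAddTorus (Fin 3))) => Literature.MathematicalPhysics.KineticTheory.empiricalEnergyField z (fun y => φ N (y - x)); let ub := fun (N : ℕ) (z : Literature.Analysis.FluidPDE.Config (N + 1) (Fin 3) (UnitAddTorus (Fin 3))) (x : (UnitAddTorus (Fin 3))) => (ρb N z x)⁻¹ • mb N z x; let θb := fun (N : ℕ) (z : Literature.Analysis.FluidPDE.Config (N + 1) (Fin 3) (UnitAddTorus (Fin 3))) (x : (UnitAddTorus (Fin 3))) => 2 / 3 * (Eb N z x / ρb N z x - ‖mb N z x‖ ^ 2 / (2 * ρb N z x ^ 2)); let pc := fun (r th : ℝ) => Literature.MathematicalPhysics.KineticTheory.hsPressure σ r th - r * th; ∀ t : ℝ, 0 < t → ∀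 (ψ : ℝ → (UnitAddTorus (Fin 3)) → (EuclideanSpace ℝ (Fin 3))) (χ : ℝ → (UnitAddTorus (Fin 3)) → ℝ), Literature.Analysis.FunctionSpaces.Torus.IsSmoothSpaceTimeOn (Icc 0 t) ψ → Literature.Analysis.FunctionSpaces.Torus.IsSmoothSpaceTimeOn (Icc 0 t) χ → let O := fun (N : ℕ) (s : ℝ) (z : Literature.Analysis.FluidPDE.Config (N + 1) (Fin 3) (UnitAddTorus (Fin 3))) => ∫ y, ((∑ j, ψ s y.1 j * y.2 j) + χ s y.1 * (‖y.2‖ ^ 2 / 2)) ∂(Literature.Analysis.FluidPDE.empiricalMeasure z); let Cc := fun (N : ℕ) (z : Literature.Analysis.FluidPDE.Config (N + 1) (Fin 3) (UnitAddTorus (Fin 3))) (τ : ℝ) => O N τ ((Φ N).flow τ z) - O N 0 ((Φ N).flow 0 z) - ∫ s in Icc 0 τ, ((∫ y, ((∑ j, Literature.Analysis.FunctionSpaces.Torus.timeDeriv ψ s y.1 j * y.2 j) + Literature.Analysis.FunctionSpaces.Torus.timeDeriv χ s y.1 * (‖y.2‖ ^ 2 / 2)) ∂(Literature.Analysis.FluidPDE.empiricalMeasure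 ((Φ N).flow s z))) + deriv (fun r : ℝ => O N s (Literature.Analysis.FluidPDE.freeFlight (Literature.Analysis.FluidPDE.Torus.geometry (Fin 3)) r ((Φ N).flow s z))) 0); ∀ δ : ℝ, 0 < δ → Tendsto (fun N : ℕ => Literature.MathematicalPhysics.KineticTheory.localGibbsLaw σ a₀ u₀ θ₀ N (Φ N) {z | ∃ τ ∈ Icc 0 t, δ < |Cc N z τ - ∫ s in Icc 0 τ, ∫ x, (Literature.Analysis.FunctionSpaces.Torus.divergence (ψ s) x + ∑ j, Literature.Analysis.FunctionSpaces.Torus.gradient (χ s) x j * ub N ((Φ N).flow s z) x j) * pc (ρb N ((Φ N).flow s z) x) (θb N ((Φ N).flow s z) x)|}) atTop (𝓝 0)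

/-- The crux is `∀ positive continuous profiles ∃ σ₀ ∀ σ < σ₀, ConclusionAt σ a₀ θ₀ u₀`
(definitional unfolding). [folklore] -/
theorem crux_iff :
    Summit.AtomisticToContinuum.HydrodynamicLimit.Theses.CollisionIsometryCLT.CollisionalTransferLocality ↔
      ∀ (a₀ θ₀ : (UnitAddTorus (Fin 3)) → ℝ) (u₀ : (UnitAddTorus (Fin 3)) → (EuclideanSpace ℝ (Fin 3))),
        Continuous a₀ → Continuous θ₀ → Continuous u₀ → (∀ x, 0 < a₀ x) → (∀ x, 0 < θ₀ x) →
        ∃ σ₀ : ℝ, 0 < σ₀ ∧ ∀ σ : ℝ, 0 < σ → σ < σ₀ → ConclusionAt σ a₀ θ₀ u₀ :=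
  Iff.rfl

/-- The two routes' items are one and the same term (shared verbatim, stmt-9518): a proof or a
refutation closes both. [folklore] -/
theorem shared_verbatim :
    Summit.AtomisticToContinuum.HydrodynamicLimit.Theses.CollisionIsometryCLT.CollisionalTransferLocality =
      Summit.AtomisticToContinuum.HydrodynamicLimit.Theses.StiffCollisionalRelaxation.CollisionalTransferLocality :=
  rfl

/-! ## Load-bearing analysis: the positivity hypotheses are vacuity guards -/

/-- If the local Gibbs laws vanish identically, the conclusion holds trivially (every event has
probability `0`). This is the mechanism behind all degenerate-profile "truths" below. [folklore] -/
theorem conclusionAt_of_law_eq_zero {σ : ℝ} {a₀ θ₀ : (UnitAddTorus (Fin 3)) → ℝ}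
    {u₀ : (UnitAddTorus (Fin 3)) → (EuclideanSpace ℝ (Fin 3))}
    (h : ∀ (N : ℕ) (Φ : Literature.Analysis.FluidPDE.HardSphereFlow
      (Literature.Analysis.FluidPDE.Torus.geometry (Fin 3)) (hsDiameter σ N) (N + 1)),
      localGibbsLaw σ a₀ u₀ θ₀ N Φ = 0) :
    ConclusionAt σ a₀ θ₀ u₀ := by
  intro Φ γ C φ _hγ _hγ' _hφ ρb mb Eb ub θb pc t _ht ψ χ _hψ _hχ O Cc δ _hδ
  simp only [h, Measure.coe_zero, Pi.zero_apply]
  exact tendsto_const_nhds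

/-- A vanishing one-particle profile gives the zero `N`-particle law: `f₀^{⊗(N+1)} = 0`, so the
canonical density and `particleLaw` vanish. [folklore] -/
theorem localGibbsLaw_eq_zero_of_profile_eq_zero {a₀ θ₀ : (UnitAddTorus (Fin 3)) → ℝ}
    {u₀ : (UnitAddTorus (Fin 3)) → (EuclideanSpace ℝ (Fin 3))}
    (h : localGibbsProfile a₀ u₀ θ₀ = 0) (σ : ℝ) (N : ℕ)
    (Φ : Literature.Analysis.FluidPDE.HardSphereFlow
      (Literature.Analysis.FluidPDE.Torus.geometry (Fin 3)) (hsDiameter σ N) (N + 1)) :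
    localGibbsLaw σ a₀ u₀ θ₀ N Φ = 0 := by
  have htp : Literature.Analysis.FluidPDE.tensorPow (N + 1) (localGibbsProfile a₀ u₀ θ₀) =
      (0 : Literature.Analysis.FluidPDE.Config (N + 1) (Fin 3) (UnitAddTorus (Fin 3)) → ℝ) := by
    funext Z
    simp [Literature.Analysis.FluidPDE.tensorPow, h]
  unfold localGibbsLaw Literature.Analysis.FluidPDE.particleLaw
    Literature.Analysis.FluidPDE.canonicalDensity
  simp [htp]

/-- At temperature profile `θ₀ ≡ 0` the local Maxwellian is Lean-junk `0`
(`(2π·0)^{-3/2} = 0`), so the local Gibbs profile is the zero function. [folklore] -/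
theorem localGibbsProfile_theta_zero (a₀ : (UnitAddTorus (Fin 3)) → ℝ)
    (u₀ : (UnitAddTorus (Fin 3)) → (EuclideanSpace ℝ (Fin 3))) :
    localGibbsProfile a₀ u₀ (fun _ => 0) = 0 := by
  funext y
  simp [localGibbsProfile, Literature.Analysis.FluidPDE.localMaxwellian]

/-- At activity profile `a₀ ≡ 0` the local Gibbs profile is the zero function. [folklore] -/
theorem localGibbsProfile_activity_zero (θ₀ : (UnitAddTorus (Fin 3)) → ℝ)
    (u₀ : (UnitAddTorus (Fin 3)) → (EuclideanSpace ℝ (Fin 3))) :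
    localGibbsProfile (fun _ => 0) u₀ θ₀ = 0 := by
  funext y
  simp [localGibbsProfile]

/-- `CollisionalTransferLocality` WITHOUT `0 < θ₀` is not refuted by the degenerate profile
`θ₀ ≡ 0`: there the conclusion is (vacuously) TRUE at every `σ`. The hypothesis is a vacuity
guard, not load-bearing. [folklore] -/
theorem conclusionAt_theta_zero (σ : ℝ) (a₀ : (UnitAddTorus (Fin 3)) → ℝ)
    (u₀ : (UnitAddTorus (Fin 3)) → (EuclideanSpace ℝ (Fin 3))) :
    ConclusionAt σ a₀ (fun _ => 0) u₀ :=
  conclusionAt_of_law_eq_zero fun N Φ =>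
    localGibbsLaw_eq_zero_of_profile_eq_zero (localGibbsProfile_theta_zero a₀ u₀) σ N Φ

/-- `CollisionalTransferLocality` WITHOUT `0 < a₀` is not refuted by `a₀ ≡ 0` either (zero law,
vacuous truth). [folklore] -/
theorem conclusionAt_activity_zero (σ : ℝ) (θ₀ : (UnitAddTorus (Fin 3)) → ℝ)
    (u₀ : (UnitAddTorus (Fin 3)) → (EuclideanSpace ℝ (Fin 3))) :
    ConclusionAt σ (fun _ => 0) θ₀ u₀ :=
  conclusionAt_of_law_eq_zero fun N Φ =>
    localGibbsLaw_eq_zero_of_profile_eq_zero (localGibbsProfile_activity_zero θ₀ u₀) σ N Φ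

/-! ## The `σ = 0` kernel and the empty-block junk: both sides vanish -/

/-- At `σ = 0` the collisional pressure `p_c = hsPressure 0 ρ θ − ρθ` vanishes identically
(`Z(0) = 1`): the ideal-gas kernel of `BoltzmannHypothesisBarrierNarrow`, which refutes the
KINETIC hinge at `σ = 0`, does not bite the collisional crux — its content is `O(σ³)`. [folklore] -/
theorem collisionalPressure_sigma_zero (r th : ℝ) : hsPressure 0 r th - r * th = 0 := by
  simp [hsPressure, hsCompressibility]

/-- On an empty block (`ρ̄ = 0`, where `ū`, `θ̄` are division-by-zero junk) the collisional
pressure term is `0`: the junk never enters the right-hand side. [folklore] -/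
theorem collisionalPressure_density_zero (σ th : ℝ) : hsPressure σ 0 th - 0 * th = 0 := by
  simp [hsPressure]

/-! ## The equilibrium rung (first honest sub-target; implied by the crux) -/

/-- **Equilibrium rung.** The crux specialised to the flow-INVARIANT homogeneous local Gibbs law
(`a₀ ≡ 1`, `u₀ ≡ 0`, `θ₀ ≡ θe`): since `∫_{𝕋³} div ψ = 0` and the block fields concentrate at
constants, it says that the collision-virial functional `Cc(τ)` tends to `0` in probability,
uniformly in `τ ≤ t` — an equilibrium law of large numbers. WHY NO KILL LIVES HERE, and why this
rung is provable with STATICS + INVARIANCE only (no mixing, no ergodicity):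
* `E[Cc(τ)] = 0` EXACTLY: the canonical law is invariant under the flow and under simultaneous
  translation of all positions, and the flow commutes with translations, so the expected jump sum
  is `∫ dy Σ (ψ(xᵢ+y) − ψ(xⱼ+y))·Δvᵢ = 0`; equivalently, through the balance law,
  `E[O(τ)] − E[O(0)] = (3θe/2)∫₀^τ∫∂ₛχ = ∫₀^τ E[A(s)]` and `E[B(s)] = θe ∫ div ψₛ = 0`.
* `Var` at FIXED `τ`: `Cc(τ) = [O]₀^τ − ∫₀^τ (A + B)` and each of `O(s, Φₛ z)`, `A(s)`, `B(s)` is an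
  empirical average of a one-particle observable `f(x) q(v)`, `q ∈ {v, |v|², v⊗v, |v|²v}`, whose law
  at time `s` is the time-0 canonical law (invariance); static Gibbs bounds give `Var = O(1/(N+1))`
  for each `s` (pair correlation `h` has an `O(1/N)` canonical part plus a range-`ε` part with
  `∫|h| ≍ ε³ = σ³/(N+1)`), and Cauchy–Schwarz in `s` gives `Var(∫₀^τ B) ≤ τ ∫₀^τ Var B(s) ds`. So the
  fixed-`τ` rung needs: invariance of the canonical law under `Φ` (Liouville + energy + domain),
  the static LLN of `HardSphereEulerLLN` extended from `(1, v, |v|²/2)` to `v⊗v` and `|v|²v`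
  weights, and dominated convergence in `s`. The right side `R(τ)` has mean `0` too (`E[ū p_c] = 0`
  by `v ↦ −v`; `E[p_c(ρ̄, θ̄)]` is `x`-independent and multiplies `∫ div ψ = 0`) — even a
  DISCONTINUOUS `Z` would not break the equilibrium rung (homogeneity), so no EOS leverage either.
* The `sup_{τ ≤ t}` costs a maximal inequality: exponential static concentration (block large
  deviations under Gibbs, Gaussian velocity tails) on a `poly(N)` grid, plus `max` over `N²` windows
  of the window virial (`O(1)` collisions × jump `(N+1)^{-4/3}|Δv|`, `|Δv| ≲ √log N` w.h.p.).
Cheapest meaningful target for provers; for the refuter it is closed territory. [folklore] -/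
def EquilibriumRung : Prop :=
  ∀ θe : ℝ, 0 < θe → ∃ σ₀ : ℝ, 0 < σ₀ ∧ ∀ σ : ℝ, 0 < σ → σ < σ₀ →
    ConclusionAt σ (fun _ => 1) (fun _ => θe) (fun _ => 0)

/-- The crux implies its equilibrium rung (specialise to constant profiles). [folklore] -/
theorem equilibriumRung_of_crux
    (h : Summit.AtomisticToContinuum.HydrodynamicLimit.Theses.CollisionIsometryCLT.CollisionalTransferLocality) :
    EquilibriumRung := fun θe hθe =>
  h (fun _ => 1) (fun _ => θe) (fun _ => 0) continuous_const continuous_const continuous_const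
    (fun _ => one_pos) (fun _ => hθe)

end

end Summit.AtomisticToContinuum.HydrodynamicLimit.Cruxes.CollisionalTransferLocality.Disproof
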